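import Summits.AtomisticToContinuum.HydrodynamicLimit.Theses.OneFlightGossipEngine
import Summits.AtomisticToContinuum.HydrodynamicLimit.Theorems.OneFlightGossipEngineCollisionActivityTailsEndpointTails
import Summits.AtomisticToContinuum.HydrodynamicLimit.Theorems.OneFlightGossipEngineCollisionActivityTailsNearFieldKineticTailsStatics
import Summits.AtomisticToContinuum.HydrodynamicLimit.Theorems.OneFlightGossipEngineEquilibriumClampedCollisionalWindowLDAdaptedClampKinematics

/-!
# Negative knowledge for the crux `CollisionActivityTails` — the functional and its kinematics

From the standing disprover's `Cruxes/CollisionActivityTails/Disproof.lean` §1–§2 (cycle 1;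
refuter-cdisprove-stmt-AtomisticToContinuum-13734-0; crux stmt-AtomisticToContinuum-13734).  The crux
decl is `Summit.AtomisticToContinuum.HydrodynamicLimit.Theses.OneFlightGossipEngine.CollisionActivityTails`
(route OneFlightGossipEngine, item #6); route TwoClocks carried the byte-identical copy
`Theses.TwoClocks.CollisionActivityTails` until its rev 10 (2026-08-16) restated it as
`TransferActivityTails` (stmt-AtomisticToContinuum-16624, momentum + energy impulse), so this file now
reads the crux back from the OneFlightGossipEngine module (statement of stmt-13734 unchanged).
Nothing here asserts the crux.  The vocabulary
`Flow`, `Cfg`, `window`, `tailFn` (+ `tailFn_of_lt`, `tailFn_of_le`, `measurable_tailFn`) is the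
one of the landed line file `OneFlightGossipEngineCollisionActivityTailsEndpointTails.lean`
(namespace `CollisionActivityTailsEndpointTails`), re-exported here, not restated.

* `collisionActivityTails_iff_activityTail` (deprecated alias `collisionActivityTails_iff`) —
  definitional read-back of the crux through `activity` / `activityTail` / `window`; basic API of
  the functional (`activity_nonneg`,
  `activityTail_le_mean`, `activityTail_zero` — with threshold `0` the tail IS the mean activity,
  `activityTail_anti`, `activityTail_eq_zero_iff`).
* KINEMATICS: the crux's summand `|v_i⁺ − v_i⁻|` of a record read off a configuration is the normal
  component `|⟨v_i − v_j, n⟩|/|n|` of the relative velocity (`impulse_ofConfig_eq`), hence at most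
  the relative speed (`impulse_ofConfig_le`, `_le_add`), and it vanishes for grazing collisions
  (`norm_reflectVel_fst_sub_eq_zero_of_grazing`): high activity at bounded speeds needs MANY
  collisions (the crux follows from collision-NUMBER tails plus velocity tails), while activity
  tails say nothing about collision counts (no converse reduction).

2026-08-17 repair (route TwoClocks rev 10 removed its copy of the crux decl): the read-back is now
`collisionActivityTails_iff_activityTail` against the OneFlightGossipEngine decl, the old name
`collisionActivityTails_iff` a deprecated alias of it; `norm_reflectVel_fst_sub_le` and `tailFn_nonneg`
became deprecated aliases of the declarations with the same statement that landed meanwhile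
(`ClampedTransferCoin.AdaptedClampKinematics.norm_reflectVel_fst_sub_le`;
`CollisionActivityTailsNearFieldKineticTails.tailFn_nonneg`, about the twin `NearFieldKineticTails.tailFn`)
and their uses here are inlined.
-/

noncomputable section

open MeasureTheory Filter Set Topology
open scoped ENNReal

namespace Summit.AtomisticToContinuum.HydrodynamicLimit.Theorems

namespace CollisionActivityTailsNegative

open Literature.MathematicalPhysics.KineticTheory Literature.Analysis.FluidPDE

export CollisionActivityTailsEndpointTails (Flow Cfg window tailFn tailFn_of_lt tailFn_of_le
  measurable_tailFn)

/-! ## §1 The crux functional -/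

/-- Collision records of `N + 1` spheres. -/
abbrev Rec (N : ℕ) : Type := HardSphereCollisionRecord (Fin 3) T3 (N + 1)

/-- The impulse received by particle `i` in the (ordered) record `c`: `|v_i⁺ - v_i⁻|` if `i` is
the first particle of the ordered pair, `0` otherwise (each binary collision of `i` appears exactly
once with `c.fst = i`). This is the crux's summand. -/
def impulseOf {N : ℕ} (i : Fin (N + 1)) (c : Rec N) : ℝ :=
  if c.fst = i then ‖c.postVel.1 - c.preVel.1‖ else 0

/-- The window activity of particle `i`: `a_i = (σ/τ) Σ_{collisions of i with times in S} |Δv_i|`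
(the crux takes `S = (s, s + w]`, `w = τ (N+1)^{-1/3}`). -/
def activity {σ : ℝ} {N : ℕ} (Φ : Flow σ N) (τ : ℝ) (S : Set ℝ) (i : Fin (N + 1)) (z : Cfg N) : ℝ :=
  σ / τ * Φ.collisionSum S (impulseOf i) z

/-- The crux's empirical activity tail `(N+1)⁻¹ Σ_i 𝟙{V < a_i} a_i` of an activity vector. -/
def activityTail (N : ℕ) (V : ℝ) (a : Fin (N + 1) → ℝ) : ℝ :=
  ((N : ℝ) + 1)⁻¹ * ∑ i : Fin (N + 1), tailFn V (a i)

/-- **Read-back.** `CollisionActivityTails` (stmt-AtomisticToContinuum-13734, decl of route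
OneFlightGossipEngine) restated through `activity` / `activityTail` / `window` (definitional unfolding
only: the `let`s of the route decl are these definitions). -/
theorem collisionActivityTails_iff_activityTail :
    Summit.AtomisticToContinuum.HydrodynamicLimit.Theses.OneFlightGossipEngine.CollisionActivityTails ↔
    ∀ (a₀ θ₀ : T3 → ℝ) (u₀ : T3 → V3), Continuous a₀ → Continuous θ₀ → Continuous u₀ →
      (∀ x, 0 < a₀ x) → (∀ x, 0 < θ₀ x) → ∃ σ₀ : ℝ, 0 < σ₀ ∧ ∀ σ : ℝ, 0 < σ → σ < σ₀ →
      ∀ (T : ℝ) (ρ θ : ℝ → T3 → ℝ) (u : ℝ → T3 → V3), IsHardSphereEulerSolution σ T ρ u θ →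
      ∀ Φ : (N : ℕ) → Flow σ N,
      TendstoHydroFieldsAt (fun N => localGibbsLaw σ a₀ u₀ θ₀ N (Φ N)) Φ ρ u θ 0 →
      ∀ t ∈ Set.Ico 0 T, ∃ V₀ : ℝ, 0 < V₀ ∧ ∀ V : ℝ, V₀ ≤ V → ∀ ε : ℝ, 0 < ε →
      ∃ τ₀ : ℝ, 0 < τ₀ ∧ ∀ τ : ℝ, τ₀ ≤ τ → ∃ N₀ : ℕ, ∀ N : ℕ, N₀ ≤ N → ∀ s ∈ Set.Icc 0 t,
        ∫⁻ z, ENNReal.ofReal (activityTail N V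
            (fun i => activity (Φ N) τ (Set.Ioc s (s + window τ N)) i z))
          ∂(localGibbsLaw σ a₀ u₀ θ₀ N (Φ N)) ≤ ENNReal.ofReal ε :=
  Iff.rfl

/-- Former read-back through the TwoClocks copy of the crux (`Theses.TwoClocks.CollisionActivityTails`,
removed by route TwoClocks rev 10 on 2026-08-16); the statement of stmt-13734 is unchanged and is
now read back from route OneFlightGossipEngine: use `collisionActivityTails_iff_activityTail`. -/
@[deprecated collisionActivityTails_iff_activityTail (since := "2026-08-17")]
alias collisionActivityTails_iff := collisionActivityTails_iff_activityTail


/-! ### §1b Basic properties of the functional -/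

/-- The tail functional of a nonnegative argument is nonnegative.  Deprecated 2026-08-17 (gate
dedup): the statement `0 ≤ y → 0 ≤ tailFn V y` had landed meanwhile as
`CollisionActivityTailsNearFieldKineticTails.tailFn_nonneg`, for that line's twin functional
`CollisionActivityTailsNearFieldKineticTails.tailFn` (same body as, hence definitionally equal to, the
`CollisionActivityTailsEndpointTails.tailFn` exported here); the old name is kept as an alias of the
landed lemma and the two uses in this file are inlined (`Set.indicator_apply_nonneg fun _ => hy`). -/
@[deprecated CollisionActivityTailsNearFieldKineticTails.tailFn_nonneg (since := "2026-08-17")]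
alias tailFn_nonneg := CollisionActivityTailsNearFieldKineticTails.tailFn_nonneg

/-- For a nonnegative threshold the tail functional is nonnegative everywhere. -/
theorem tailFn_nonneg_of_threshold {V : ℝ} (hV : 0 ≤ V) (y : ℝ) : 0 ≤ tailFn V y :=
  Set.indicator_nonneg (fun _ (h : V < _) => hV.trans h.le) _

/-- The tail functional is dominated by the (nonnegative) argument. -/
theorem tailFn_le_self {V y : ℝ} (hy : 0 ≤ y) : tailFn V y ≤ y :=
  Set.indicator_apply_le' (fun _ => le_rfl) (fun _ => hy)

/-- The tail is antitone in the threshold (on nonnegative arguments). -/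
theorem tailFn_anti {V V' y : ℝ} (hVV' : V ≤ V') (hy : 0 ≤ y) : tailFn V' y ≤ tailFn V y := by
  by_cases h : V' < y
  · rw [tailFn_of_lt h, tailFn_of_lt (hVV'.trans_lt h)]
  · rw [tailFn_of_le (not_lt.1 h)]
    exact Set.indicator_apply_nonneg fun _ => hy

/-- With threshold `0` the "tail" is the whole (nonnegative) quantity. -/
theorem tailFn_zero {y : ℝ} (hy : 0 ≤ y) : tailFn 0 y = y := by
  rcases hy.lt_or_eq with h | h
  · exact tailFn_of_lt h
  · rw [← h, tailFn_of_le le_rfl]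

/-- The impulse summand is nonnegative. -/
theorem impulseOf_nonneg {N : ℕ} (i : Fin (N + 1)) (c : Rec N) : 0 ≤ impulseOf i c := by
  unfold impulseOf
  split_ifs
  · exact norm_nonneg _
  · exact le_rfl

/-- A collision sum of a nonnegative functional is nonnegative (a `finsum` of finite sums of
nonnegative terms; also in the junk case of infinitely many collision times, where it is `0`). -/
theorem collisionSum_nonneg {σ : ℝ} {N : ℕ} (Φ : Flow σ N) (S : Set ℝ) {F : Rec N → ℝ}
    (hF : ∀ c, 0 ≤ F c) (z : Cfg N) : 0 ≤ Φ.collisionSum S F z := by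
  unfold HardSphereFlow.collisionSum Literature.Analysis.FluidPDE.collisionSum
    Literature.Analysis.FluidPDE.collisionPairSum
  exact finsum_nonneg fun t => finsum_nonneg fun _ => Finset.sum_nonneg fun p _ => hF _

/-- The window activity is nonnegative (for `σ, τ ≥ 0`). -/
theorem activity_nonneg {σ : ℝ} {N : ℕ} (hσ : 0 ≤ σ) {τ : ℝ} (hτ : 0 ≤ τ) (Φ : Flow σ N)
    (S : Set ℝ) (i : Fin (N + 1)) (z : Cfg N) : 0 ≤ activity Φ τ S i z :=
  mul_nonneg (div_nonneg hσ hτ) (collisionSum_nonneg Φ S (impulseOf_nonneg i) z)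

/-- The activity tail of a nonnegative activity vector is nonnegative. -/
theorem activityTail_nonneg {N : ℕ} {V : ℝ} {a : Fin (N + 1) → ℝ} (ha : ∀ i, 0 ≤ a i) :
    0 ≤ activityTail N V a :=
  mul_nonneg (by positivity)
    (Finset.sum_nonneg fun i _ => Set.indicator_apply_nonneg fun _ => ha i)

/-- The activity tail is at most the mean activity `(N+1)⁻¹ Σ_i a_i`. -/
theorem activityTail_le_mean {N : ℕ} (V : ℝ) {a : Fin (N + 1) → ℝ} (ha : ∀ i, 0 ≤ a i) :
    activityTail N V a ≤ ((N : ℝ) + 1)⁻¹ * ∑ i : Fin (N + 1), a i :=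
  mul_le_mul_of_nonneg_left (Finset.sum_le_sum fun i _ => tailFn_le_self (ha i)) (by positivity)

/-- With threshold `0` the activity tail IS the mean activity. -/
theorem activityTail_zero {N : ℕ} {a : Fin (N + 1) → ℝ} (ha : ∀ i, 0 ≤ a i) :
    activityTail N 0 a = ((N : ℝ) + 1)⁻¹ * ∑ i : Fin (N + 1), a i := by
  unfold activityTail
  congr 1
  exact Finset.sum_congr rfl fun i _ => tailFn_zero (ha i)

/-- The activity tail is antitone in the threshold. -/
theorem activityTail_anti {N : ℕ} {V V' : ℝ} (hVV' : V ≤ V') {a : Fin (N + 1) → ℝ}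
    (ha : ∀ i, 0 ≤ a i) : activityTail N V' a ≤ activityTail N V a :=
  mul_le_mul_of_nonneg_left (Finset.sum_le_sum fun i _ => tailFn_anti hVV' (ha i)) (by positivity)

/-- The activity tail vanishes iff every activity is at most the threshold (for `V ≥ 0`). -/
theorem activityTail_eq_zero_iff {N : ℕ} {V : ℝ} (hV : 0 ≤ V) (a : Fin (N + 1) → ℝ) :
    activityTail N V a = 0 ↔ ∀ i, a i ≤ V := by
  unfold activityTail
  have hpos : (0 : ℝ) < ((N : ℝ) + 1)⁻¹ := by positivity
  rw [mul_eq_zero, or_iff_right hpos.ne']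
  rw [Finset.sum_eq_zero_iff_of_nonneg fun i _ => tailFn_nonneg_of_threshold hV (a i)]
  simp only [Finset.mem_univ, forall_const]
  refine forall_congr' fun i => ⟨fun h => ?_, fun h => tailFn_of_le h⟩
  by_contra hlt
  rw [not_le] at hlt
  rw [tailFn_of_lt hlt] at h
  exact (hV.trans_lt hlt).ne' h

/-! ## §2 Kinematics of one collision: impulse = |normal relative velocity| ≤ relative speed

The crux's summand `|v_i⁺ - v_i⁻|` is, for a record read off a configuration
(`HardSphereCollisionRecord.ofConfig`, the only records a `collisionSum` ever sees), the normal
component `|⟨v_i - v_j, n⟩|/|n|` of the relative velocity along the impact vector `n = x_i - x_j`: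
it is bounded by the relative speed (so high activity at bounded speeds needs MANY collisions:
the crux is implied by a collision-NUMBER tail bound plus velocity tails), and it VANISHES for
grazing collisions (so the converse reduction fails: activity tails say nothing about collision
counts). -/

section Kinematics

variable {E : Type*} [NormedAddCommGroup E] [InnerProductSpace ℝ E]

/-- The velocity jump of the first partner under the reflection law. -/
theorem reflectVel_fst_sub (n : E) (p : E × E) :
    (reflectVel n p).1 - p.1 = -((inner ℝ (p.1 - p.2) n / ‖n‖ ^ 2) • n) := by
  simp only [reflectVel]
  abel

/-- The velocity jump of the second partner under the reflection law. -/
theorem reflectVel_snd_sub (n : E) (p : E × E) :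
    (reflectVel n p).2 - p.2 = (inner ℝ (p.1 - p.2) n / ‖n‖ ^ 2) • n := by
  simp only [reflectVel]
  abel

/-- The velocity jump of the first partner is the normal component of the relative velocity. -/
theorem norm_reflectVel_fst_sub (n : E) (p : E × E) :
    ‖(reflectVel n p).1 - p.1‖ = |inner ℝ (p.1 - p.2) n| / ‖n‖ := by
  rw [reflectVel_fst_sub, norm_neg, norm_smul, Real.norm_eq_abs, abs_div,
    abs_of_nonneg (sq_nonneg ‖n‖)]
  by_cases hn : n = 0
  · simp [hn]
  · have hn' : ‖n‖ ≠ 0 := norm_ne_zero_iff.2 hn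
    field_simp

/-- Both partners receive the same impulse. -/
theorem norm_reflectVel_snd_sub (n : E) (p : E × E) :
    ‖(reflectVel n p).2 - p.2‖ = ‖(reflectVel n p).1 - p.1‖ := by
  rw [reflectVel_snd_sub, reflectVel_fst_sub, norm_neg]

/-- **Impulse ≤ relative speed** (Cauchy–Schwarz), `‖(reflectVel n p).1 - p.1‖ ≤ ‖p.1 - p.2‖`.
Deprecated 2026-08-17 (gate dedup): the same statement had landed meanwhile as
`ClampedTransferCoin.AdaptedClampKinematics.norm_reflectVel_fst_sub_le`; the old name is kept as an
alias of it (this file's one use, `impulse_ofConfig_le`, is inlined). -/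
@[deprecated ClampedTransferCoin.AdaptedClampKinematics.norm_reflectVel_fst_sub_le
  (since := "2026-08-17")]
alias norm_reflectVel_fst_sub_le :=
  ClampedTransferCoin.AdaptedClampKinematics.norm_reflectVel_fst_sub_le

/-- **Grazing collisions transfer nothing**: if the relative velocity is orthogonal to the impact
vector, the impulse vanishes (no lower bound per collision). -/
theorem norm_reflectVel_fst_sub_eq_zero_of_grazing {n : E} {p : E × E}
    (h : inner ℝ (p.1 - p.2) n = 0) : ‖(reflectVel n p).1 - p.1‖ = 0 := by
  rw [norm_reflectVel_fst_sub, h, abs_zero, zero_div]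

end Kinematics

/-- For a record read off a configuration, the crux's summand `|v_fst⁺ - v_fst⁻|` is at most the
relative speed of the pair (**impulse ≤ relative speed**, Cauchy–Schwarz on the closed form
`norm_reflectVel_fst_sub`; the generic-`E` form `‖(reflectVel n p).1 - p.1‖ ≤ ‖p.1 - p.2‖` is the
landed `ClampedTransferCoin.AdaptedClampKinematics.norm_reflectVel_fst_sub_le`), hence at most
`|v_i| + |v_j|`. -/
theorem impulse_ofConfig_le {d : Type*} [Fintype d] {X : Type*} {n : ℕ} (G : Geometry d X)
    (ε : ℝ) (z : Config n d X) (t : ℝ) (i j : Fin n) :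
    ‖(HardSphereCollisionRecord.ofConfig G ε z t i j).postVel.1 -
        (HardSphereCollisionRecord.ofConfig G ε z t i j).preVel.1‖ ≤ ‖(z i).2 - (z j).2‖ := by
  have key : ∀ (nv : EuclideanSpace ℝ d) (p : EuclideanSpace ℝ d × EuclideanSpace ℝ d),
      ‖(reflectVel nv p).1 - p.1‖ ≤ ‖p.1 - p.2‖ := fun nv p => by
    rw [norm_reflectVel_fst_sub]
    by_cases hn : nv = 0
    · simp [hn]
    · rw [div_le_iff₀ (norm_pos_iff.2 hn)]
      exact abs_real_inner_le_norm _ _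
  simp only [HardSphereCollisionRecord.ofConfig_postVel, HardSphereCollisionRecord.ofConfig_preVel]
  rw [← norm_neg, neg_sub]
  exact key _ _

/-- The crux's summand is at most the sum of the two speeds. -/
theorem impulse_ofConfig_le_add {d : Type*} [Fintype d] {X : Type*} {n : ℕ} (G : Geometry d X)
    (ε : ℝ) (z : Config n d X) (t : ℝ) (i j : Fin n) :
    ‖(HardSphereCollisionRecord.ofConfig G ε z t i j).postVel.1 -
        (HardSphereCollisionRecord.ofConfig G ε z t i j).preVel.1‖ ≤ ‖(z i).2‖ + ‖(z j).2‖ :=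
  (impulse_ofConfig_le G ε z t i j).trans (norm_sub_le _ _)

/-- The crux's summand for a record read off a configuration, in closed form: the normal
component of the relative velocity along the separation vector. -/
theorem impulse_ofConfig_eq {d : Type*} [Fintype d] {X : Type*} {n : ℕ} (G : Geometry d X)
    (ε : ℝ) (z : Config n d X) (t : ℝ) (i j : Fin n) :
    ‖(HardSphereCollisionRecord.ofConfig G ε z t i j).postVel.1 -
        (HardSphereCollisionRecord.ofConfig G ε z t i j).preVel.1‖ =
      |inner ℝ ((z i).2 - (z j).2) (G.sepVec (z i).1 (z j).1)| / ‖G.sepVec (z i).1 (z j).1‖ := by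
  simp only [HardSphereCollisionRecord.ofConfig_postVel, HardSphereCollisionRecord.ofConfig_preVel]
  rw [← norm_neg, neg_sub]
  exact norm_reflectVel_fst_sub _ _




end CollisionActivityTailsNegative

end Summit.AtomisticToContinuum.HydrodynamicLimit.Theorems
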